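import Literature.Probability.Process.LocalRubberCompact
import Literature.MathematicalPhysics.StatisticalMechanics.LocalMatchingCompactness

/-!
# Crux `GappedShellCensus.CleanLimitExtractionR` (stmt-AtomisticToContinuum-18072), line
# `CleanLimitExtractionR_CandidateProof` — stub A `stub_cleRGappedOfTendsto`

GAPPED-TWELVE IS CLOSED under local-rubber limits of `δ`-separated configurations (sitewise, with
radius loss).  Setting: configurations `S k : LocalConfig ℝ³`, all `δ`-separated, converging in the
local rubber topology (`LocalConfig.tendsto_iff_locallyMatches`: eventual two-way `(R, η)`-matching
for all `R`, `η > 0`) to `Y`; a site `y ∈ Y` with `‖y‖ < r`; eventually every site of `S k` in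
`B̄(0, r)` is gapped-twelve at scale `a > 0`.  Conclusion: `y` is gapped-twelve at scale `a` in `Y`.

Proof.  (1) `cleR_radial_of_tendsto`: the radial clause (all other points of `Y` at distance in
`[0.98a, 1.02a] ∪ [1.26a, ∞)` from `y`) passes to the limit because that distance set is closed.
(2) `cleR_gappedTwelve_transfer` (finite, limit-free COLLAR TRANSFER): two `δ`-separated
configurations two-way `(R, η)`-matched with `2η < δ`, `25η < a` have the same shell count at
matched sites, because the shell boundary spheres `0.98a`, `1.02a` sit inside particle-free collars
(hard-core moat, Hales gap `(1.02a, 1.26a)`) wider than `2η`, so the matching restricts to a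
bijection of the two bond shells.  (3) Apply (2) to one fine matching given by the convergence.
Ported from the checked crux workfile `Cruxes/CleanLimitExtractionR/SketchIdeator2.lean` (crux-ideate,
ideator 2; farm rc 0, H21 audit `proof-of-item closed:true`); the route's clauses (gapped-twelve,
fcc/hcp-typed shell, clean site) are written out verbatim — no definitions, no notations.
-/

noncomputable section

namespace Summit.AtomisticToContinuum.Crystallization.Theorems

open Filter Topology Set
open scoped Classical
open Literature.Probability.Process Literature.MathematicalPhysics.StatisticalMechanics

/-- COLLAR TRANSFER (finite, limit-free).  Two `δ`-separated configurations that are two-way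
`(R, η)`-matched with `2η < δ`, `25η < a` have the SAME gapped-twelve status at matched sites,
provided the second one is radially admissible there: the matching restricts to a bijection of the
two bond shells because their boundary spheres `0.98a`, `1.02a` sit inside particle-free collars
(the hard-core moat below `0.98a` and the Hales gap `(1.02a, 1.26a)`), both wider than `2η`. -/
theorem cleR_gappedTwelve_transfer {S S' : Set (EuclideanSpace ℝ (Fin 3))} {a δ η R : ℝ} (ha : 0 < a) (hδ : 0 < δ)
    (_hη : 0 ≤ η) (h2η : 2 * η < δ) (hηa : 25 * η < a)
    (hS : ∀ u ∈ S, ∀ v ∈ S, u ≠ v → δ ≤ dist u v)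
    (hS' : ∀ u ∈ S', ∀ v ∈ S', u ≠ v → δ ≤ dist u v)
    (hm : LocallyMatches R η S S') {p p' : EuclideanSpace ℝ (Fin 3)} (_hp : p ∈ S) (_hp' : p' ∈ S')
    (hpp' : dist p p' ≤ η) (hR : ‖p‖ + 2 * a ≤ R)
    (hg : ({w ∈ S | w ≠ p ∧ dist p w ≤ a * (1 + 1 / 50)}.ncard = 12 ∧
          ∀ w ∈ S, w ≠ p → a * (1 - 1 / 50) ≤ dist p w ∧
            (dist p w ≤ a * (1 + 1 / 50) ∨ a * (63 / 50) ≤ dist p w)))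
    (hrad : ∀ w ∈ S', w ≠ p' → a * (1 - 1 / 50) ≤ dist p' w ∧
      (dist p' w ≤ a * (1 + 1 / 50) ∨ a * (63 / 50) ≤ dist p' w)) :
    ({w ∈ S' | w ≠ p' ∧ dist p' w ≤ a * (1 + 1 / 50)}.ncard = 12 ∧
          ∀ w ∈ S', w ≠ p' → a * (1 - 1 / 50) ≤ dist p' w ∧
            (dist p' w ≤ a * (1 + 1 / 50) ∨ a * (63 / 50) ≤ dist p' w)) := by
  obtain ⟨hcount, hradS⟩ := hg
  refine ⟨?_, hrad⟩
  set A : Set (EuclideanSpace ℝ (Fin 3)) := {w ∈ S | w ≠ p ∧ dist p w ≤ a * (1 + 1 / 50)} with hA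
  set B : Set (EuclideanSpace ℝ (Fin 3)) := {w ∈ S' | w ≠ p' ∧ dist p' w ≤ a * (1 + 1 / 50)} with hB
  -- both shells are finite (separated subsets of closed balls)
  have hAfin : A.Finite := by
    refine finite_of_forall_le_dist_of_subset_closedBall hδ
      (fun u hu v hv huv => hS u hu.1 v hv.1 huv) (c := p) (R := a * (1 + 1 / 50)) ?_
    intro w hw
    exact Metric.mem_closedBall.2 (by rw [dist_comm]; exact hw.2.2)
  have hBfin : B.Finite := by
    refine finite_of_forall_le_dist_of_subset_closedBall hδ
      (fun u hu v hv huv => hS' u hu.1 v hv.1 huv) (c := p') (R := a * (1 + 1 / 50)) ?_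
    intro w hw
    exact Metric.mem_closedBall.2 (by rw [dist_comm]; exact hw.2.2)
  have hpp'' : dist p' p ≤ η := by rw [dist_comm]; exact hpp'
  -- shell of `p` in `S` ↦ shell of `p'` in `S'`
  have hAto : ∀ w ∈ A, ∃ w' ∈ B, dist w w' ≤ η := by
    intro w hw
    obtain ⟨hwS, hwp, hdw⟩ := hw
    have hwR : ‖w‖ ≤ R := by
      have h1 := norm_sub_norm_le w p
      rw [← dist_eq_norm, dist_comm] at h1
      nlinarith [ha]
    obtain ⟨w', hw'S, hww'⟩ := hm.2 w hwS hwR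
    have hlow : a * (1 - 1 / 50) ≤ dist p w := (hradS w hwS hwp).1
    have hne : w' ≠ p' := by
      intro h
      rw [h] at hww'
      have : dist p w ≤ dist p p' + dist w p' := dist_triangle_right p w p'
      nlinarith [ha]
    have hup : dist p' w' ≤ a * (1 + 1 / 50) + 2 * η :=
      calc dist p' w' ≤ dist p' p + dist p w' := dist_triangle _ _ _
        _ ≤ dist p' p + (dist p w + dist w w') := by gcongr; exact dist_triangle _ _ _
        _ ≤ η + (a * (1 + 1 / 50) + η) := by gcongr
        _ = a * (1 + 1 / 50) + 2 * η := by ring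
    refine ⟨w', ⟨hw'S, hne, ?_⟩, hww'⟩
    rcases (hrad w' hw'S hne).2 with h | h
    · exact h
    · exfalso; nlinarith [ha]
  -- shell of `p'` in `S'` ↦ shell of `p` in `S`
  have hBto : ∀ w' ∈ B, ∃ w ∈ A, dist w w' ≤ η := by
    intro w' hw'
    obtain ⟨hw'S, hw'p, hdw'⟩ := hw'
    have hw'R : ‖w'‖ ≤ R := by
      have h1 := norm_sub_norm_le w' p'
      rw [← dist_eq_norm, dist_comm] at h1
      have h2 := norm_sub_norm_le p' p
      rw [← dist_eq_norm] at h2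
      nlinarith [ha]
    obtain ⟨w, hwS, hww'⟩ := hm.1 w' hw'S hw'R
    have hlow : a * (1 - 1 / 50) ≤ dist p' w' := (hrad w' hw'S hw'p).1
    have hne : w ≠ p := by
      intro h
      rw [h] at hww'
      have : dist p' w' ≤ dist p' p + dist p w' := dist_triangle _ _ _
      nlinarith [ha]
    have hup : dist p w ≤ a * (1 + 1 / 50) + 2 * η :=
      calc dist p w ≤ dist p p' + dist p' w := dist_triangle _ _ _
        _ ≤ dist p p' + (dist p' w' + dist w' w) := by gcongr; exact dist_triangle _ _ _
        _ ≤ η + (a * (1 + 1 / 50) + η) := by gcongr; rw [dist_comm]; exact hww'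
        _ = a * (1 + 1 / 50) + 2 * η := by ring
    refine ⟨w, ⟨hwS, hne, ?_⟩, hww'⟩
    rcases (hradS w hwS hne).2 with h | h
    · exact h
    · exfalso; nlinarith [ha]
  -- the two maps are injective because `2η < δ`
  choose! f hf using hAto
  choose! g hg using hBto
  have hfinj : Set.InjOn f A := by
    intro w₁ h₁ w₂ h₂ heq
    by_contra hne
    have hsep := hS w₁ h₁.1 w₂ h₂.1 hne
    have : dist w₁ w₂ ≤ 2 * η :=
      calc dist w₁ w₂ ≤ dist w₁ (f w₁) + dist w₂ (f w₁) := dist_triangle_right _ _ _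
        _ ≤ η + η := by
            gcongr
            · exact (hf w₁ h₁).2
            · rw [heq]; exact (hf w₂ h₂).2
        _ = 2 * η := by ring
    linarith
  have hginj : Set.InjOn g B := by
    intro w₁ h₁ w₂ h₂ heq
    by_contra hne
    have hsep := hS' w₁ h₁.1 w₂ h₂.1 hne
    have : dist w₁ w₂ ≤ 2 * η :=
      calc dist w₁ w₂ ≤ dist (g w₁) w₁ + dist (g w₁) w₂ := dist_triangle_left _ _ _
        _ ≤ η + η := by
            gcongr
            · exact (hg w₁ h₁).2
            · rw [heq]; exact (hg w₂ h₂).2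
        _ = 2 * η := by ring
    linarith
  have h1 : A.ncard ≤ B.ncard := Set.ncard_le_ncard_of_injOn f (fun w hw => (hf w hw).1) hfinj hBfin
  have h2 : B.ncard ≤ A.ncard := Set.ncard_le_ncard_of_injOn g (fun w hw => (hg w hw).1) hginj hAfin
  omega

/-- RADIAL ADMISSIBILITY IS CLOSED along local-rubber limits (the allowed distance set
`{0} ∪ [0.98a, 1.02a] ∪ [1.26a, ∞)` is closed): at every small matching scale `η` the limit
distance `dist y w` is `2η`-close to an admissible stage distance. -/
theorem cleR_radial_of_tendsto {S : ℕ → LocalConfig (EuclideanSpace ℝ (Fin 3))} {Y : LocalConfig (EuclideanSpace ℝ (Fin 3))} {a δ : ℝ} (ha : 0 < a)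
    (_hδ : 0 < δ) (_hS : ∀ k, ∀ u ∈ S k, ∀ v ∈ S k, u ≠ v → δ ≤ dist u v)
    (hY : Tendsto S atTop (𝓝 Y)) {y : EuclideanSpace ℝ (Fin 3)} {r : ℝ} (hy : y ∈ Y) (hyr : ‖y‖ < r)
    (hgood : ∀ᶠ k in atTop, ∀ p ∈ S k, ‖p‖ ≤ r → ({w ∈ (S k : Set (EuclideanSpace ℝ (Fin 3))) | w ≠ p ∧ dist p w ≤ a * (1 + 1 / 50)}.ncard = 12 ∧
          ∀ w ∈ (S k : Set (EuclideanSpace ℝ (Fin 3))), w ≠ p → a * (1 - 1 / 50) ≤ dist p w ∧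
            (dist p w ≤ a * (1 + 1 / 50) ∨ a * (63 / 50) ≤ dist p w))) :
    ∀ w ∈ (Y : Set (EuclideanSpace ℝ (Fin 3))), w ≠ y → a * (1 - 1 / 50) ≤ dist y w ∧
      (dist y w ≤ a * (1 + 1 / 50) ∨ a * (63 / 50) ≤ dist y w) := by
  intro w hw hne
  have hyw : 0 < dist y w := dist_pos.2 (Ne.symm hne)
  have hr : 0 < r - ‖y‖ := by linarith
  -- key approximation: at every small scale `η` the distance `dist y w` is `2η`-close to an admissible one
  have key : ∀ η : ℝ, 0 < η → η ≤ r - ‖y‖ → 2 * η < dist y w →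
      ∃ d : ℝ, |d - dist y w| ≤ 2 * η ∧ a * (1 - 1 / 50) ≤ d ∧
        (d ≤ a * (1 + 1 / 50) ∨ a * (63 / 50) ≤ d) := by
    intro η hη hηr hη2
    obtain ⟨k, hmatch, hgk⟩ :=
      (((LocalConfig.tendsto_iff_locallyMatches.1 hY) (max ‖y‖ ‖w‖) η hη).and hgood).exists
    obtain ⟨p, hp, hyp⟩ := hmatch.2 y hy (le_max_left _ _)
    obtain ⟨q, hq, hwq⟩ := hmatch.2 w hw (le_max_right _ _)
    have hpq : p ≠ q := by
      intro h
      rw [h] at hyp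
      have : dist y w ≤ dist y q + dist w q := dist_triangle_right _ _ _
      linarith
    have hpnorm : ‖p‖ ≤ r := by
      have h1 := norm_sub_norm_le p y
      rw [← dist_eq_norm, dist_comm] at h1
      linarith
    obtain ⟨-, hradS⟩ := hgk p hp hpnorm
    obtain ⟨hlo, hdisj⟩ := hradS q hq (Ne.symm hpq)
    refine ⟨dist p q, ?_, hlo, hdisj⟩
    rw [abs_sub_le_iff]
    constructor
    · have : dist p q ≤ dist p y + (dist y w + dist w q) :=
        (dist_triangle p y q).trans (by gcongr; exact dist_triangle _ _ _)
      rw [dist_comm p y] at this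
      linarith
    · have : dist y w ≤ dist y p + (dist p q + dist q w) :=
        (dist_triangle y p w).trans (by gcongr; exact dist_triangle _ _ _)
      rw [dist_comm q w] at this
      linarith
  have hlow : a * (1 - 1 / 50) ≤ dist y w := by
    refine le_of_forall_pos_lt_add fun ε hε => ?_
    have hm0 : 0 < min (r - ‖y‖) (min (dist y w / 4) (ε / 4)) :=
      lt_min hr (lt_min (by linarith) (by linarith))
    have hm1 : min (r - ‖y‖) (min (dist y w / 4) (ε / 4)) ≤ dist y w / 4 :=
      (min_le_right _ _).trans (min_le_left _ _)
    have hm2 : min (r - ‖y‖) (min (dist y w / 4) (ε / 4)) ≤ ε / 4 :=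
      (min_le_right _ _).trans (min_le_right _ _)
    obtain ⟨d, hd, hlo, -⟩ := key _ hm0 (min_le_left _ _) (by linarith)
    have h1 := (abs_sub_le_iff.1 hd).1
    linarith
  refine ⟨hlow, ?_⟩
  by_cases hcase : dist y w ≤ a * (1 + 1 / 50)
  · exact Or.inl hcase
  · right
    push Not at hcase
    refine le_of_forall_pos_lt_add fun ε hε => ?_
    have hgap0 : 0 < dist y w - a * (1 + 1 / 50) := by linarith
    have hm0 : 0 < min (r - ‖y‖) (min (dist y w / 4) (min (ε / 4) ((dist y w - a * (1 + 1 / 50)) / 4))) :=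
      lt_min hr (lt_min (by linarith) (lt_min (by linarith) (by linarith)))
    have hm1 : min (r - ‖y‖) (min (dist y w / 4) (min (ε / 4) ((dist y w - a * (1 + 1 / 50)) / 4))) ≤
        dist y w / 4 := (min_le_right _ _).trans (min_le_left _ _)
    have hm2 : min (r - ‖y‖) (min (dist y w / 4) (min (ε / 4) ((dist y w - a * (1 + 1 / 50)) / 4))) ≤
        ε / 4 := ((min_le_right _ _).trans (min_le_right _ _)).trans (min_le_left _ _)
    have hm3 : min (r - ‖y‖) (min (dist y w / 4) (min (ε / 4) ((dist y w - a * (1 + 1 / 50)) / 4))) ≤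
        (dist y w - a * (1 + 1 / 50)) / 4 :=
      ((min_le_right _ _).trans (min_le_right _ _)).trans (min_le_right _ _)
    obtain ⟨d, hd, -, hdisj⟩ := key _ hm0 (min_le_left _ _) (by linarith)
    obtain ⟨h1, h2⟩ := abs_sub_le_iff.1 hd
    rcases hdisj with h | h
    · exfalso
      linarith
    · linarith

/-- **Stub A — GAPPED-TWELVE IS CLOSED under local-rubber limits** of `δ`-separated
configurations (sitewise, with radius loss): if `S k → Y` in `LocalConfig ℝ³`, all `S k` are
`δ`-separated, `y ∈ Y`, `‖y‖ < r`, and eventually every site of `S k` in `B̄(0, r)` is gapped-twelve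
at scale `a > 0` (twelve other points in the closed bond shell `dist ≤ 1.02 a`, none closer than
`0.98 a`, none in the open annulus `(1.02 a, 1.26 a)`), then `y` is gapped-twelve at scale `a` in
`Y` — `cleR_radial_of_tendsto` plus `cleR_gappedTwelve_transfer` applied to one fine matching
(`LocalConfig.tendsto_iff_locallyMatches`). -/
theorem stub_cleRGappedOfTendsto {S : ℕ → LocalConfig (EuclideanSpace ℝ (Fin 3))} {Y : LocalConfig (EuclideanSpace ℝ (Fin 3))} {a δ : ℝ}
    (ha : 0 < a) (hδ : 0 < δ) (hS : ∀ k, ∀ u ∈ S k, ∀ v ∈ S k, u ≠ v → δ ≤ dist u v)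
    (hY : Tendsto S atTop (𝓝 Y)) {y : EuclideanSpace ℝ (Fin 3)} {r : ℝ} (hy : y ∈ Y) (hyr : ‖y‖ < r)
    (hgood : ∀ᶠ k in atTop, ∀ p ∈ S k, ‖p‖ ≤ r → ({w ∈ (S k : Set (EuclideanSpace ℝ (Fin 3))) | w ≠ p ∧ dist p w ≤ a * (1 + 1 / 50)}.ncard = 12 ∧
          ∀ w ∈ (S k : Set (EuclideanSpace ℝ (Fin 3))), w ≠ p → a * (1 - 1 / 50) ≤ dist p w ∧
            (dist p w ≤ a * (1 + 1 / 50) ∨ a * (63 / 50) ≤ dist p w))) :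
    ({w ∈ (Y : Set (EuclideanSpace ℝ (Fin 3))) | w ≠ y ∧ dist y w ≤ a * (1 + 1 / 50)}.ncard = 12 ∧
          ∀ w ∈ (Y : Set (EuclideanSpace ℝ (Fin 3))), w ≠ y → a * (1 - 1 / 50) ≤ dist y w ∧
            (dist y w ≤ a * (1 + 1 / 50) ∨ a * (63 / 50) ≤ dist y w)) := by
  have hrad := cleR_radial_of_tendsto ha hδ hS hY hy hyr hgood
  have hr : 0 < r - ‖y‖ := by linarith
  -- the limit is `δ`-separated (closed class)
  have hYsep : ∀ u ∈ Y, ∀ v ∈ Y, u ≠ v → δ ≤ dist u v :=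
    (LocalConfig.isClosed_setOf_separated δ).mem_of_tendsto hY (Eventually.of_forall hS)
  -- a fine matching scale
  set η : ℝ := min (δ / 4) (min (a / 50) (min ((r - ‖y‖) / 2) 1)) with hη_def
  have hη : 0 < η := lt_min (by positivity) (lt_min (by positivity) (lt_min (by positivity) one_pos))
  have hηδ : η ≤ δ / 4 := min_le_left _ _
  have hηa : η ≤ a / 50 := (min_le_right _ _).trans (min_le_left _ _)
  have hηr : η ≤ (r - ‖y‖) / 2 := ((min_le_right _ _).trans (min_le_right _ _)).trans (min_le_left _ _)
  have hη1 : η ≤ 1 := ((min_le_right _ _).trans (min_le_right _ _)).trans (min_le_right _ _)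
  obtain ⟨k, hmatch, hgk⟩ :=
    (((LocalConfig.tendsto_iff_locallyMatches.1 hY) (‖y‖ + 1 + 2 * a) η hη).and hgood).exists
  obtain ⟨p, hp, hyp⟩ := hmatch.2 y hy (by linarith)
  have hpn : ‖p‖ ≤ ‖y‖ + η := by
    have h1 := norm_sub_norm_le p y
    rw [← dist_eq_norm, dist_comm] at h1
    linarith
  have hg : ({w ∈ (S k : Set (EuclideanSpace ℝ (Fin 3))) | w ≠ p ∧ dist p w ≤ a * (1 + 1 / 50)}.ncard = 12 ∧
        ∀ w ∈ (S k : Set (EuclideanSpace ℝ (Fin 3))), w ≠ p → a * (1 - 1 / 50) ≤ dist p w ∧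
          (dist p w ≤ a * (1 + 1 / 50) ∨ a * (63 / 50) ≤ dist p w)) := hgk p hp (by linarith)
  exact cleR_gappedTwelve_transfer ha hδ hη.le (by linarith) (by linarith) (hS k) hYsep hmatch.symm hp hy
    (by rw [dist_comm]; exact hyp) (by linarith) hg hrad

end Summit.AtomisticToContinuum.Crystallization.Theorems

end
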